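import Summits.CriticalPhenomena.PercolationContinuityZ3.Theorems.PercNearOneGluingNoHeavyLowerTailCubicThreePointTerminalClosure
import Mathlib.Topology.Order.IntermediateValue
import Mathlib.Topology.Algebra.Order.Field
import Mathlib.Analysis.Normed.Field.Basic
import Mathlib.Topology.Instances.Real.Lemmas
import Mathlib.Tactic.Ring
import Mathlib.Tactic.Linarith
import Mathlib.Tactic.Positivity
import Mathlib.Tactic.LinearCombination
import HarnessLib

/-!
# `NoHeavyLowerTail` (stmt-CriticalPhenomena-4575) — the sharp cubic row `SF3-Hmax` has NO LAW-LEVEL REGIME CERTIFICATE: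
# every decomposition `M·Ha = σ₀ + (t − q)·σ₁` with `σ₀, σ₁ ≥ 0` on the star and triangle laws forces `M ≤ 0` at the
# self-dual symmetric law

Support file (prover prim-gen-kcluster gen 32, k-cluster / sharp-cubic-row line; `--supports stmt-CriticalPhenomena-4575`;
memo `run/shared/lean/prim/prim-gen-kcluster/KCLUSTER-gen32.md`).  Pure real algebra + two one-sided limits; no measure theory,
no definitions, no named facts, no sorries.  Cell convention of `…CubicThreePointTerminalClosure` (`CubicThreePointTerminal.AG/Ha/Hb`):
`(q, u₁, u₂, u₃, t) = (P(a|b|c), P(ab|c), P(ac|b), P(bc|a), P(abc))`, `AG = qt − e₂(u)`, `Ha = t·AG − e₃ (= P(abc)² − P(ab)P(ac)P(bc))`,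
`Hb = q·AG − e₃`, `Ha − Hb = (t − q)·AG` (`Ha_sub_Hb`).

## The statement being obstructed

The conjecture of record C1 = `SF3-Hmax` (memo KCLUSTER-FINAL §3; census-true, open) is the REGIME statement
`t ≥ q ⟹ Ha ≥ 0` (dense half; the sparse half `q ≥ t ⟹ Hb ≥ 0` is its dual under `q ↔ t`).  A *law-level regime certificate*
for it is an identity
  `M(ℓ)·Ha(ℓ) = σ₀(ℓ) + (t − q)·σ₁(ℓ)`  for all realizable five-cell laws `ℓ = (q,u₁,u₂,u₃,t)`,
with `σ₀, σ₁ ≥ 0` on all realizable laws and a multiplier `M` (usually `M ≡ 1`, or a Pólya/Handelman multiplier `> 0` on the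
open simplex).  Every LP / Handelman / Pólya / SOS / Positivstellensatz certificate "target ∈ cone(valid rows) + (t − q)·cone(valid
rows)" is of this form, whatever the rows are — present ones (Harris, Gladkov's `AG`, `AG⁺`, `3PT-LB`, `T_inc`, GZ kernel rows, …)
or any valid row found in the future — as long as the rows are functions of the five-cell law of the structure: products of valid
rows are `≥ 0` on realizable laws and continuous.

## Theorem (this file): no such certificate exists

Let `x₀ ∈ (0,1)` be the root of `−x³ + 3x² − 1` (`exists_selfDual_root`; `x₀ = 0.6527…`, the Sykes–Essam / Y–Δ point
`p = 1 − x₀ = 2 sin(π/18)`), and `ℓ* = (x₀³, u*, u*, u*, x₀³)`, `u* = x₀²(1 − x₀)`, the common law of the symmetric STAR with arm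
`x₀` and of the symmetric TRIANGLE with edge `1 − x₀` (star–triangle duality, `…SharpDichotomy.triangle_eq_dual_star_*`; the two
laws coincide exactly when the star is self-dual, `t⋆ = q⋆`).  Both families are realizable (graphs), so any certificate satisfies
the hypotheses below on them.
* `multiplier_nonpos_at_selfDual`: if `M·Ha = σ₀ + (t−q)·σ₁` holds along the symmetric star laws and along the symmetric triangle
  laws, with `σ₀, σ₁ ≥ 0` there and `M, σ₁` continuous at `ℓ*`, then `M(ℓ*) ≤ 0`.
* `no_lawLevel_regime_certificate`: hence NO certificate with `M ≡ 1`; `no_positive_multiplier_certificate`: none with a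
  multiplier `M > 0` on the open simplex (all Pólya `(q+u₁+u₂+u₃+t)^N`, Handelman and monomial multipliers); stated for arbitrary
  functions `σ₀, σ₁` of the law (`σ₁` continuous), in particular for polynomial ones of ANY degree.
PROOF (two one-sided limits at `ℓ*`).  Along the stars `Ha ≡ 0` (`Ha_symStar`) and `t − q = −x³ + 3x² − 1 > 0` for `x > x₀`
(`selfDual_pos`), so `0 = σ₀ + (t−q)σ₁` with both terms `≥ 0` forces `σ₁(star x) = 0`, whence `σ₁(ℓ*) = 0` (`x → x₀⁺`).  Along the
triangles `Hb ≡ 0`, so `Ha = (t − q)·AG` with `AG = x³(1−x)³ > 0` (`Ha_symTriangle`) and `t − q = −(−x³ + 3x² − 1) < 0` for `x > x₀`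
(sparse side): the identity reads `σ₀ = (t−q)·(M·AG − σ₁) ≥ 0`, forcing `σ₁(tri x) ≥ M(tri x)·AG`; `x → x₀⁺` gives
`σ₁(ℓ*) ≥ M(ℓ*)·AG(ℓ*)`, i.e. `M(ℓ*)·x₀³(1−x₀)³ ≤ 0`.  ∎  In words: the "ideal multiplier" `Ha/(t − q)` restricted to realizable
laws is `0` along the dense stars and `AG > 0` along the sparse triangles, which meet at `ℓ*`; no function of the law interpolates.

## Scope (what this does and does not rule out)

* RULED OUT: every certificate of `SF3-Hmax` (either half) whose ingredients are functions of the five-cell law — at any degree,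
  over any family of valid law-level rows, with unit or positive multipliers.  The same holds verbatim for the abstract row (monotone
  maps `Qₙ → M₃`) and for prim-ineq-gen-2's `GW` at the level of the 8-atom law of three up-sets (stars and triangles have no
  singleton atoms, so an 8-atom certificate restricts to a 5-cell one), and for rows on `k`-point laws that must hold for every
  placement of the auxiliary points (isolated auxiliary points make the `k`-point laws of the two families functions of their
  3-point laws, meeting at the lift of `ℓ*`).  A multiplier `M ≥ 0` can only survive if it VANISHES on the whole self-dual star
  locus (the argument applies at every self-dual star law with `AG > 0`, not only the symmetric one).
* NOT ruled out (the live routes, KCLUSTER-FINAL §4): certificates whose `σ₁` is a functional of the STRUCTURE finer than its law —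
  the lineage's shadow form `W_a` (`S_a = Ha − (t−q)·X_a`, `X_a` a conditional second moment: `0` on hub networks, `AG` on blob
  networks, which is exactly the behaviour forced above), prim-ineq-gen-2's `SHAD`/fibre forms, switching (multi-copy) certificates,
  and structural / inductive proofs.  This file turns the lineage's observation "every census-clean linearisation
  `Ha ≥ (t−q)·Z` has a TWO-COPY `Z`" (KCLUSTER-gen21 (O5): `Z = X_a`, `u₃·n`, `S_q^nat`) into a theorem: `Z` cannot be a function of
  the law, continuous or not at any other point, because the dense stars and the sparse triangles prescribe incompatible values of
  it at `ℓ*`; and it closes the law-level cone approach (new valid rows + regime multiplier) for this row for good.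
[folklore] (elementary real analysis; the star–triangle coincidence is [cite: GrimmettManolescuAOP2013, star–triangle transformation])
-/

namespace Summit.CriticalPhenomena.PercolationContinuityZ3.Theorems

namespace CubicThreePointLawLevel

open CubicThreePointTerminal Filter Topology Set

/-! ### The two symmetric one-parameter families through the self-dual law -/

/-- `Ha ≡ 0` on the symmetric STAR law with arm `x`:
`(q,u,u,u,t) = (1 − 3x² + 2x³, x²(1−x), x²(1−x), x²(1−x), x³)` (hub network: `P(abc)² = P(ab)P(ac)P(bc)`). [folklore] -/
theorem Ha_symStar (x : ℝ) :
    Ha (1 - 3 * x ^ 2 + 2 * x ^ 3) (x ^ 2 * (1 - x)) (x ^ 2 * (1 - x)) (x ^ 2 * (1 - x)) (x ^ 3) = 0 := by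
  simp only [Ha]; ring

/-- On the symmetric TRIANGLE law with all edges `1 − x` (the `q ↔ t` dual of the symmetric star:
`(q,u,u,u,t) = (x³, x²(1−x), x²(1−x), x²(1−x), 1 − 3x² + 2x³)`), `Hb ≡ 0` and hence
`Ha = (t − q)·AG = (1 − 3x² + x³)·x³(1−x)³`. [folklore] -/
theorem Ha_symTriangle (x : ℝ) :
    Ha (x ^ 3) (x ^ 2 * (1 - x)) (x ^ 2 * (1 - x)) (x ^ 2 * (1 - x)) (1 - 3 * x ^ 2 + 2 * x ^ 3) =
      (1 - 3 * x ^ 2 + x ^ 3) * (x ^ 3 * (1 - x) ^ 3) := by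
  simp only [Ha]; ring

/-- `Hb ≡ 0` on the symmetric triangle law (blob network: `P(a|b|c)² = ∏ P(i ∤ rest)`). [folklore] -/
theorem Hb_symTriangle (x : ℝ) :
    Hb (x ^ 3) (x ^ 2 * (1 - x)) (x ^ 2 * (1 - x)) (x ^ 2 * (1 - x)) (1 - 3 * x ^ 2 + 2 * x ^ 3) = 0 := by
  simp only [Hb]; ring

/-- Gladkov's form on the symmetric star (and, by self-duality of `AG`, on the symmetric triangle): `AG = x³(1−x)³`. [folklore] -/
theorem AG_symStar (x : ℝ) :
    AG (1 - 3 * x ^ 2 + 2 * x ^ 3) (x ^ 2 * (1 - x)) (x ^ 2 * (1 - x)) (x ^ 2 * (1 - x)) (x ^ 3) =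
      x ^ 3 * (1 - x) ^ 3 := by
  simp only [AG]; ring

/-- `AG = x³(1−x)³` on the symmetric triangle law as well. [folklore] -/
theorem AG_symTriangle (x : ℝ) :
    AG (x ^ 3) (x ^ 2 * (1 - x)) (x ^ 2 * (1 - x)) (x ^ 2 * (1 - x)) (1 - 3 * x ^ 2 + 2 * x ^ 3) =
      x ^ 3 * (1 - x) ^ 3 := by
  simp only [AG]; ring

/-- The self-duality defect of the symmetric star, `t⋆ − q⋆ = −x³ + 3x² − 1`, has a root `x₀ ∈ (0,1)` (intermediate value theorem;
`x₀ = 0.65270…`, `1 − x₀ = 2 sin(π/18)` is the Sykes–Essam star–triangle point). [folklore] -/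
theorem exists_selfDual_root : ∃ x ∈ Ioo (0 : ℝ) 1, -x ^ 3 + 3 * x ^ 2 - 1 = 0 := by
  have hc : ContinuousOn (fun x : ℝ => -x ^ 3 + 3 * x ^ 2 - 1) (Icc 0 1) := by fun_prop
  have h := intermediate_value_Ioo (le_of_lt (zero_lt_one' ℝ)) hc
  have h0 : (0 : ℝ) ∈ Ioo ((fun x : ℝ => -x ^ 3 + 3 * x ^ 2 - 1) 0) ((fun x : ℝ => -x ^ 3 + 3 * x ^ 2 - 1) 1) := by
    simp only [Ioo, mem_setOf_eq]; norm_num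
  obtain ⟨x, hx, hx0⟩ := h h0
  exact ⟨x, hx, hx0⟩

/-- Past the root the symmetric star is strictly dense (`t⋆ > q⋆`) — equivalently the dual triangle is strictly sparse:
`−x³ + 3x² − 1 > 0` for `x₀ < x < 1` (the defect is increasing on `(0,1)`). [folklore] -/
theorem selfDual_pos {x₀ x : ℝ} (h₀ : 0 < x₀) (hroot : -x₀ ^ 3 + 3 * x₀ ^ 2 - 1 = 0) (hx : x₀ < x) (hx1 : x < 1) :
    0 < -x ^ 3 + 3 * x ^ 2 - 1 := by
  have key : -x ^ 3 + 3 * x ^ 2 - 1 = (x - x₀) * (3 * (x + x₀) - (x ^ 2 + x * x₀ + x₀ ^ 2)) := by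
    linear_combination hroot
  rw [key]
  apply mul_pos (by linarith)
  nlinarith [mul_pos h₀ (sub_pos.mpr hx1), mul_pos (h₀.trans hx) (sub_pos.mpr hx1)]

/-- At the root the two symmetric families have the SAME law `ℓ* = (x₀³, u*, u*, u*, x₀³)`: `q⋆ = 1 − 3x₀² + 2x₀³ = x₀³ = t⋆`. [folklore] -/
theorem selfDual_q_eq_t {x₀ : ℝ} (hroot : -x₀ ^ 3 + 3 * x₀ ^ 2 - 1 = 0) : 1 - 3 * x₀ ^ 2 + 2 * x₀ ^ 3 = x₀ ^ 3 := by
  linear_combination (-1 : ℝ) * hroot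

/-! ### The obstruction -/

/-- **No law-level regime certificate for the sharp cubic row — multiplier form.**  Let `x₀ ∈ (0,1)` be the self-dual root and
`ℓ* = (x₀³, x₀²(1−x₀), x₀²(1−x₀), x₀²(1−x₀), x₀³)` the common symmetric star / triangle law.  If functions `M, σ₀, σ₁` of the
five-cell law satisfy `M·Ha = σ₀ + (t − q)·σ₁` with `σ₀, σ₁ ≥ 0` along the symmetric star laws AND along the symmetric triangle
laws (as every identity over valid law-level rows does, both families being realizable), and `M, σ₁` are continuous at `ℓ*`,
then `M(ℓ*) ≤ 0`.  (Dense stars force `σ₁(ℓ*) = 0`; sparse triangles force `σ₁(ℓ*) ≥ M(ℓ*)·AG(ℓ*)` with `AG(ℓ*) = x₀³(1−x₀)³ > 0`.) [folklore] -/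
theorem multiplier_nonpos_at_selfDual
    (M σ₀ σ₁ : ℝ × ℝ × ℝ × ℝ × ℝ → ℝ) {x₀ : ℝ} (hx₀ : x₀ ∈ Ioo (0 : ℝ) 1)
    (hroot : -x₀ ^ 3 + 3 * x₀ ^ 2 - 1 = 0)
    (hM : ContinuousAt M (x₀ ^ 3, x₀ ^ 2 * (1 - x₀), x₀ ^ 2 * (1 - x₀), x₀ ^ 2 * (1 - x₀), x₀ ^ 3))
    (hσ₁ : ContinuousAt σ₁ (x₀ ^ 3, x₀ ^ 2 * (1 - x₀), x₀ ^ 2 * (1 - x₀), x₀ ^ 2 * (1 - x₀), x₀ ^ 3))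
    (hstar : ∀ x ∈ Ioo (0 : ℝ) 1,
      M (1 - 3 * x ^ 2 + 2 * x ^ 3, x ^ 2 * (1 - x), x ^ 2 * (1 - x), x ^ 2 * (1 - x), x ^ 3) *
          Ha (1 - 3 * x ^ 2 + 2 * x ^ 3) (x ^ 2 * (1 - x)) (x ^ 2 * (1 - x)) (x ^ 2 * (1 - x)) (x ^ 3) =
        σ₀ (1 - 3 * x ^ 2 + 2 * x ^ 3, x ^ 2 * (1 - x), x ^ 2 * (1 - x), x ^ 2 * (1 - x), x ^ 3) +
          (x ^ 3 - (1 - 3 * x ^ 2 + 2 * x ^ 3)) *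
            σ₁ (1 - 3 * x ^ 2 + 2 * x ^ 3, x ^ 2 * (1 - x), x ^ 2 * (1 - x), x ^ 2 * (1 - x), x ^ 3) ∧
      0 ≤ σ₀ (1 - 3 * x ^ 2 + 2 * x ^ 3, x ^ 2 * (1 - x), x ^ 2 * (1 - x), x ^ 2 * (1 - x), x ^ 3) ∧
      0 ≤ σ₁ (1 - 3 * x ^ 2 + 2 * x ^ 3, x ^ 2 * (1 - x), x ^ 2 * (1 - x), x ^ 2 * (1 - x), x ^ 3))
    (htri : ∀ x ∈ Ioo (0 : ℝ) 1,
      M (x ^ 3, x ^ 2 * (1 - x), x ^ 2 * (1 - x), x ^ 2 * (1 - x), 1 - 3 * x ^ 2 + 2 * x ^ 3) *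
          Ha (x ^ 3) (x ^ 2 * (1 - x)) (x ^ 2 * (1 - x)) (x ^ 2 * (1 - x)) (1 - 3 * x ^ 2 + 2 * x ^ 3) =
        σ₀ (x ^ 3, x ^ 2 * (1 - x), x ^ 2 * (1 - x), x ^ 2 * (1 - x), 1 - 3 * x ^ 2 + 2 * x ^ 3) +
          ((1 - 3 * x ^ 2 + 2 * x ^ 3) - x ^ 3) *
            σ₁ (x ^ 3, x ^ 2 * (1 - x), x ^ 2 * (1 - x), x ^ 2 * (1 - x), 1 - 3 * x ^ 2 + 2 * x ^ 3) ∧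
      0 ≤ σ₀ (x ^ 3, x ^ 2 * (1 - x), x ^ 2 * (1 - x), x ^ 2 * (1 - x), 1 - 3 * x ^ 2 + 2 * x ^ 3) ∧
      0 ≤ σ₁ (x ^ 3, x ^ 2 * (1 - x), x ^ 2 * (1 - x), x ^ 2 * (1 - x), 1 - 3 * x ^ 2 + 2 * x ^ 3)) :
    M (x₀ ^ 3, x₀ ^ 2 * (1 - x₀), x₀ ^ 2 * (1 - x₀), x₀ ^ 2 * (1 - x₀), x₀ ^ 3) ≤ 0 := by
  obtain ⟨h₀, h₁⟩ := hx₀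
  -- the two curves through the self-dual law ℓ* : star (t = x³) and triangle (q = x³)
  set star : ℝ → ℝ × ℝ × ℝ × ℝ × ℝ :=
    fun x => (1 - 3 * x ^ 2 + 2 * x ^ 3, x ^ 2 * (1 - x), x ^ 2 * (1 - x), x ^ 2 * (1 - x), x ^ 3) with hstar_def
  set tri : ℝ → ℝ × ℝ × ℝ × ℝ × ℝ :=
    fun x => (x ^ 3, x ^ 2 * (1 - x), x ^ 2 * (1 - x), x ^ 2 * (1 - x), 1 - 3 * x ^ 2 + 2 * x ^ 3) with htri_def
  have hstar_c : Continuous star := by rw [hstar_def]; fun_prop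
  have htri_c : Continuous tri := by rw [htri_def]; fun_prop
  have hq₀ : 1 - 3 * x₀ ^ 2 + 2 * x₀ ^ 3 = x₀ ^ 3 := selfDual_q_eq_t hroot
  have hstar₀ : star x₀ = (x₀ ^ 3, x₀ ^ 2 * (1 - x₀), x₀ ^ 2 * (1 - x₀), x₀ ^ 2 * (1 - x₀), x₀ ^ 3) := by
    simp only [hstar_def, hq₀]
  have htri₀ : tri x₀ = (x₀ ^ 3, x₀ ^ 2 * (1 - x₀), x₀ ^ 2 * (1 - x₀), x₀ ^ 2 * (1 - x₀), x₀ ^ 3) := by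
    simp only [htri_def, hq₀]
  -- (1) dense stars: σ₁ ∘ star = 0 on (x₀, 1)
  have hzero : ∀ x ∈ Ioo x₀ 1, σ₁ (star x) = 0 := by
    intro x hx
    have hφ := selfDual_pos h₀ hroot hx.1 hx.2
    obtain ⟨hid, hσ₀x, hσ₁x⟩ := hstar x ⟨h₀.trans hx.1, hx.2⟩
    rw [Ha_symStar, mul_zero] at hid
    have h1 : (x ^ 3 - (1 - 3 * x ^ 2 + 2 * x ^ 3)) = -x ^ 3 + 3 * x ^ 2 - 1 := by ring
    rw [h1] at hid
    have : σ₁ (star x) =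
        σ₁ (1 - 3 * x ^ 2 + 2 * x ^ 3, x ^ 2 * (1 - x), x ^ 2 * (1 - x), x ^ 2 * (1 - x), x ^ 3) := rfl
    rw [this]
    nlinarith [mul_nonneg hφ.le hσ₁x]
  -- (2) hence σ₁ ℓ* = 0
  have hIoo : Ioo x₀ 1 ∈ 𝓝[>] x₀ := Ioo_mem_nhdsGT h₁
  have hσ₁star : Tendsto (fun x => σ₁ (star x)) (𝓝[>] x₀) (𝓝 (σ₁ (star x₀))) := by
    have hc : ContinuousAt (fun x => σ₁ (star x)) x₀ :=
      ContinuousAt.comp (by rw [hstar₀]; exact hσ₁) hstar_c.continuousAt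
    exact hc.continuousWithinAt.tendsto
  have hσ₁0 : σ₁ (star x₀) = 0 := by
    have hev : (fun x => σ₁ (star x)) =ᶠ[𝓝[>] x₀] fun _ => (0 : ℝ) :=
      Filter.mem_of_superset hIoo (fun x hx => hzero x hx)
    have h2 : Tendsto (fun _ : ℝ => (0 : ℝ)) (𝓝[>] x₀) (𝓝 (σ₁ (star x₀))) := hσ₁star.congr' hev
    exact (tendsto_const_nhds_iff.mp h2).symm
  -- (3) sparse triangles: M(tri x)·AG − σ₁(tri x) ≤ 0 on (x₀, 1)
  have hle : ∀ x ∈ Ioo x₀ 1, M (tri x) * (x ^ 3 * (1 - x) ^ 3) - σ₁ (tri x) ≤ 0 := by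
    intro x hx
    have hφ := selfDual_pos h₀ hroot hx.1 hx.2
    obtain ⟨hid, hσ₀x, hσ₁x⟩ := htri x ⟨h₀.trans hx.1, hx.2⟩
    rw [Ha_symTriangle] at hid
    have h1 : ((1 - 3 * x ^ 2 + 2 * x ^ 3) - x ^ 3) = -(-x ^ 3 + 3 * x ^ 2 - 1) := by ring
    have h2 : (1 - 3 * x ^ 2 + x ^ 3) = -(-x ^ 3 + 3 * x ^ 2 - 1) := by ring
    rw [h1, h2] at hid
    have hM' : M (tri x) =
        M (x ^ 3, x ^ 2 * (1 - x), x ^ 2 * (1 - x), x ^ 2 * (1 - x), 1 - 3 * x ^ 2 + 2 * x ^ 3) := rfl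
    have hσ' : σ₁ (tri x) =
        σ₁ (x ^ 3, x ^ 2 * (1 - x), x ^ 2 * (1 - x), x ^ 2 * (1 - x), 1 - 3 * x ^ 2 + 2 * x ^ 3) := rfl
    rw [hM', hσ']
    -- the identity reads σ₀ = −φ·(M·AG − σ₁) with φ > 0 and σ₀ ≥ 0
    by_contra hcon
    rw [not_le] at hcon
    nlinarith [mul_pos hφ hcon]
  -- (4) pass to the limit x → x₀⁺
  have hlim : Tendsto (fun x => M (tri x) * (x ^ 3 * (1 - x) ^ 3) - σ₁ (tri x)) (𝓝[>] x₀)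
      (𝓝 (M (tri x₀) * (x₀ ^ 3 * (1 - x₀) ^ 3) - σ₁ (tri x₀))) := by
    have hcM : ContinuousAt (fun x => M (tri x)) x₀ :=
      ContinuousAt.comp (by rw [htri₀]; exact hM) htri_c.continuousAt
    have hcσ : ContinuousAt (fun x => σ₁ (tri x)) x₀ :=
      ContinuousAt.comp (by rw [htri₀]; exact hσ₁) htri_c.continuousAt
    have hcp : ContinuousAt (fun x : ℝ => x ^ 3 * (1 - x) ^ 3) x₀ := by fun_prop
    exact ((hcM.mul hcp).sub hcσ).continuousWithinAt.tendsto
  have hev2 : ∀ᶠ x in 𝓝[>] x₀, M (tri x) * (x ^ 3 * (1 - x) ^ 3) - σ₁ (tri x) ≤ 0 :=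
    Filter.mem_of_superset hIoo (fun x hx => hle x hx)
  have hfin : M (tri x₀) * (x₀ ^ 3 * (1 - x₀) ^ 3) - σ₁ (tri x₀) ≤ 0 := le_of_tendsto hlim hev2
  rw [htri₀] at hfin
  rw [hstar₀] at hσ₁0
  rw [hσ₁0, sub_zero] at hfin
  have hAG : 0 < x₀ ^ 3 * (1 - x₀) ^ 3 := by
    have : 0 < 1 - x₀ := by linarith
    positivity
  rcases mul_nonpos_iff.mp hfin with ⟨_, h2⟩ | ⟨h1, _⟩
  · exact absurd h2 (not_le.mpr hAG)
  · exact h1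

/-- **The sparse half has no law-level regime certificate either** (dual statement, `q ↔ t`): if `M·Hb = σ₀ + (q − t)·σ₁` along
the symmetric star and triangle laws with `σ₀, σ₁ ≥ 0` there and `M, σ₁` continuous at `ℓ*`, then `M(ℓ*) ≤ 0` (now the sparse
triangles force `σ₁(ℓ*) = 0` and the dense stars force `σ₁(ℓ*) ≥ M(ℓ*)·AG(ℓ*)`). [folklore] -/
theorem multiplier_nonpos_at_selfDual_sparse
    (M σ₀ σ₁ : ℝ × ℝ × ℝ × ℝ × ℝ → ℝ) {x₀ : ℝ} (hx₀ : x₀ ∈ Ioo (0 : ℝ) 1)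
    (hroot : -x₀ ^ 3 + 3 * x₀ ^ 2 - 1 = 0)
    (hM : ContinuousAt M (x₀ ^ 3, x₀ ^ 2 * (1 - x₀), x₀ ^ 2 * (1 - x₀), x₀ ^ 2 * (1 - x₀), x₀ ^ 3))
    (hσ₁ : ContinuousAt σ₁ (x₀ ^ 3, x₀ ^ 2 * (1 - x₀), x₀ ^ 2 * (1 - x₀), x₀ ^ 2 * (1 - x₀), x₀ ^ 3))
    (hstar : ∀ x ∈ Ioo (0 : ℝ) 1,
      M (1 - 3 * x ^ 2 + 2 * x ^ 3, x ^ 2 * (1 - x), x ^ 2 * (1 - x), x ^ 2 * (1 - x), x ^ 3) *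
          Hb (1 - 3 * x ^ 2 + 2 * x ^ 3) (x ^ 2 * (1 - x)) (x ^ 2 * (1 - x)) (x ^ 2 * (1 - x)) (x ^ 3) =
        σ₀ (1 - 3 * x ^ 2 + 2 * x ^ 3, x ^ 2 * (1 - x), x ^ 2 * (1 - x), x ^ 2 * (1 - x), x ^ 3) +
          ((1 - 3 * x ^ 2 + 2 * x ^ 3) - x ^ 3) *
            σ₁ (1 - 3 * x ^ 2 + 2 * x ^ 3, x ^ 2 * (1 - x), x ^ 2 * (1 - x), x ^ 2 * (1 - x), x ^ 3) ∧
      0 ≤ σ₀ (1 - 3 * x ^ 2 + 2 * x ^ 3, x ^ 2 * (1 - x), x ^ 2 * (1 - x), x ^ 2 * (1 - x), x ^ 3) ∧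
      0 ≤ σ₁ (1 - 3 * x ^ 2 + 2 * x ^ 3, x ^ 2 * (1 - x), x ^ 2 * (1 - x), x ^ 2 * (1 - x), x ^ 3))
    (htri : ∀ x ∈ Ioo (0 : ℝ) 1,
      M (x ^ 3, x ^ 2 * (1 - x), x ^ 2 * (1 - x), x ^ 2 * (1 - x), 1 - 3 * x ^ 2 + 2 * x ^ 3) *
          Hb (x ^ 3) (x ^ 2 * (1 - x)) (x ^ 2 * (1 - x)) (x ^ 2 * (1 - x)) (1 - 3 * x ^ 2 + 2 * x ^ 3) =
        σ₀ (x ^ 3, x ^ 2 * (1 - x), x ^ 2 * (1 - x), x ^ 2 * (1 - x), 1 - 3 * x ^ 2 + 2 * x ^ 3) +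
          (x ^ 3 - (1 - 3 * x ^ 2 + 2 * x ^ 3)) *
            σ₁ (x ^ 3, x ^ 2 * (1 - x), x ^ 2 * (1 - x), x ^ 2 * (1 - x), 1 - 3 * x ^ 2 + 2 * x ^ 3) ∧
      0 ≤ σ₀ (x ^ 3, x ^ 2 * (1 - x), x ^ 2 * (1 - x), x ^ 2 * (1 - x), 1 - 3 * x ^ 2 + 2 * x ^ 3) ∧
      0 ≤ σ₁ (x ^ 3, x ^ 2 * (1 - x), x ^ 2 * (1 - x), x ^ 2 * (1 - x), 1 - 3 * x ^ 2 + 2 * x ^ 3)) :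
    M (x₀ ^ 3, x₀ ^ 2 * (1 - x₀), x₀ ^ 2 * (1 - x₀), x₀ ^ 2 * (1 - x₀), x₀ ^ 3) ≤ 0 := by
  -- apply the dense statement to the functions composed with the duality `D (q,u₁,u₂,u₃,t) = (t,u₁,u₂,u₃,q)`;
  -- `D` maps the star law to the triangle law and fixes `ℓ*`, and `Hb ∘ D = Ha`.
  set D : ℝ × ℝ × ℝ × ℝ × ℝ → ℝ × ℝ × ℝ × ℝ × ℝ := fun ℓ => (ℓ.2.2.2.2, ℓ.2.1, ℓ.2.2.1, ℓ.2.2.2.1, ℓ.1) with hD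
  have hDc : Continuous D := by rw [hD]; fun_prop
  have hDfix : D (x₀ ^ 3, x₀ ^ 2 * (1 - x₀), x₀ ^ 2 * (1 - x₀), x₀ ^ 2 * (1 - x₀), x₀ ^ 3) =
      (x₀ ^ 3, x₀ ^ 2 * (1 - x₀), x₀ ^ 2 * (1 - x₀), x₀ ^ 2 * (1 - x₀), x₀ ^ 3) := by simp only [hD]
  have hHa_star : ∀ x : ℝ, Ha (1 - 3 * x ^ 2 + 2 * x ^ 3) (x ^ 2 * (1 - x)) (x ^ 2 * (1 - x)) (x ^ 2 * (1 - x)) (x ^ 3)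
      = Hb (x ^ 3) (x ^ 2 * (1 - x)) (x ^ 2 * (1 - x)) (x ^ 2 * (1 - x)) (1 - 3 * x ^ 2 + 2 * x ^ 3) := by
    intro x; simp only [Ha, Hb]; ring
  have hHa_tri : ∀ x : ℝ, Ha (x ^ 3) (x ^ 2 * (1 - x)) (x ^ 2 * (1 - x)) (x ^ 2 * (1 - x)) (1 - 3 * x ^ 2 + 2 * x ^ 3)
      = Hb (1 - 3 * x ^ 2 + 2 * x ^ 3) (x ^ 2 * (1 - x)) (x ^ 2 * (1 - x)) (x ^ 2 * (1 - x)) (x ^ 3) := by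
    intro x; simp only [Ha, Hb]; ring
  have h := multiplier_nonpos_at_selfDual (M ∘ D) (σ₀ ∘ D) (σ₁ ∘ D) hx₀ hroot
    (ContinuousAt.comp (by rw [hDfix]; exact hM) hDc.continuousAt)
    (ContinuousAt.comp (by rw [hDfix]; exact hσ₁) hDc.continuousAt)
    (fun x hx => by
      simp only [Function.comp, hD, hHa_star]
      exact htri x hx)
    (fun x hx => by
      simp only [Function.comp, hD, hHa_tri]
      exact hstar x hx)
  simpa only [Function.comp, hD] using h

/-- **No law-level regime certificate with unit multiplier.**  There are no functions `σ₀, σ₁` of the five-cell law, `σ₁`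
continuous, with `Ha = σ₀ + (t − q)·σ₁` identically and `σ₀, σ₁ ≥ 0` on the (realizable) star and triangle laws — in
particular no LP / SOS / Handelman / Positivstellensatz certificate of `t ≥ q ⟹ Ha ≥ 0` over ANY family of valid law-level
rows, of any degree.  (Hypotheses are only asked on the two symmetric families, which makes the statement stronger.) [folklore] -/
theorem no_lawLevel_regime_certificate (σ₀ σ₁ : ℝ × ℝ × ℝ × ℝ × ℝ → ℝ) (hσ₁ : Continuous σ₁)
    (hid : ∀ q u₁ u₂ u₃ t : ℝ, Ha q u₁ u₂ u₃ t = σ₀ (q, u₁, u₂, u₃, t) + (t - q) * σ₁ (q, u₁, u₂, u₃, t))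
    (hstar : ∀ x ∈ Ioo (0 : ℝ) 1,
      0 ≤ σ₀ (1 - 3 * x ^ 2 + 2 * x ^ 3, x ^ 2 * (1 - x), x ^ 2 * (1 - x), x ^ 2 * (1 - x), x ^ 3) ∧
      0 ≤ σ₁ (1 - 3 * x ^ 2 + 2 * x ^ 3, x ^ 2 * (1 - x), x ^ 2 * (1 - x), x ^ 2 * (1 - x), x ^ 3))
    (htri : ∀ x ∈ Ioo (0 : ℝ) 1,
      0 ≤ σ₀ (x ^ 3, x ^ 2 * (1 - x), x ^ 2 * (1 - x), x ^ 2 * (1 - x), 1 - 3 * x ^ 2 + 2 * x ^ 3) ∧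
      0 ≤ σ₁ (x ^ 3, x ^ 2 * (1 - x), x ^ 2 * (1 - x), x ^ 2 * (1 - x), 1 - 3 * x ^ 2 + 2 * x ^ 3)) :
    False := by
  obtain ⟨x₀, hx₀, hroot⟩ := exists_selfDual_root
  have h := multiplier_nonpos_at_selfDual (fun _ => (1 : ℝ)) σ₀ σ₁ hx₀ hroot continuousAt_const hσ₁.continuousAt
    (fun x hx => ⟨by rw [one_mul]; exact hid _ _ _ _ _, hstar x hx⟩)
    (fun x hx => ⟨by rw [one_mul]; exact hid _ _ _ _ _, htri x hx⟩)
  exact absurd h (not_le.mpr one_pos)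

/-- **No law-level regime certificate with a positive multiplier.**  There are no functions `M, σ₀, σ₁` of the five-cell law,
`M, σ₁` continuous, `M > 0` on the open simplex (e.g. Pólya multipliers `(q+u₁+u₂+u₃+t)^N`, Handelman / monomial multipliers),
with `M·Ha = σ₀ + (t − q)·σ₁` identically and `σ₀, σ₁ ≥ 0` on the star and triangle laws: a multiplier can only help if it
vanishes at the self-dual star/triangle laws. [folklore] -/
theorem no_positive_multiplier_certificate (M σ₀ σ₁ : ℝ × ℝ × ℝ × ℝ × ℝ → ℝ) (hM : Continuous M) (hσ₁ : Continuous σ₁)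
    (hpos : ∀ q u₁ u₂ u₃ t : ℝ, 0 < q → 0 < u₁ → 0 < u₂ → 0 < u₃ → 0 < t → 0 < M (q, u₁, u₂, u₃, t))
    (hid : ∀ q u₁ u₂ u₃ t : ℝ,
      M (q, u₁, u₂, u₃, t) * Ha q u₁ u₂ u₃ t = σ₀ (q, u₁, u₂, u₃, t) + (t - q) * σ₁ (q, u₁, u₂, u₃, t))
    (hstar : ∀ x ∈ Ioo (0 : ℝ) 1,
      0 ≤ σ₀ (1 - 3 * x ^ 2 + 2 * x ^ 3, x ^ 2 * (1 - x), x ^ 2 * (1 - x), x ^ 2 * (1 - x), x ^ 3) ∧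
      0 ≤ σ₁ (1 - 3 * x ^ 2 + 2 * x ^ 3, x ^ 2 * (1 - x), x ^ 2 * (1 - x), x ^ 2 * (1 - x), x ^ 3))
    (htri : ∀ x ∈ Ioo (0 : ℝ) 1,
      0 ≤ σ₀ (x ^ 3, x ^ 2 * (1 - x), x ^ 2 * (1 - x), x ^ 2 * (1 - x), 1 - 3 * x ^ 2 + 2 * x ^ 3) ∧
      0 ≤ σ₁ (x ^ 3, x ^ 2 * (1 - x), x ^ 2 * (1 - x), x ^ 2 * (1 - x), 1 - 3 * x ^ 2 + 2 * x ^ 3)) :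
    False := by
  obtain ⟨x₀, hx₀, hroot⟩ := exists_selfDual_root
  have h := multiplier_nonpos_at_selfDual M σ₀ σ₁ hx₀ hroot hM.continuousAt hσ₁.continuousAt
    (fun x hx => ⟨hid _ _ _ _ _, hstar x hx⟩) (fun x hx => ⟨hid _ _ _ _ _, htri x hx⟩)
  have hx3 : 0 < x₀ ^ 3 := by have := hx₀.1; positivity
  have hu : 0 < x₀ ^ 2 * (1 - x₀) := by
    have h1 : 0 < 1 - x₀ := by linarith [hx₀.2]
    have := hx₀.1
    positivity
  exact absurd h (not_le.mpr (hpos _ _ _ _ _ hx3 hu hu hu hx3))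

end CubicThreePointLawLevel

end Summit.CriticalPhenomena.PercolationContinuityZ3.Theorems
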